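import Mathlib
import Summits.Ventures.HodgeRepro.Tier4.Target
import Summits.Ventures.HodgeRepro.Tier4.Common.TargetData
import Summits.Ventures.HodgeRepro.Tier4.Line4.MixedTransfer

/-!
# Tier4/Line4/Forms11 — the DEFINED vocabulary of the `(1,1)`-side of LINE L4: Wirtinger derivatives, closedness,
smoothness, the `(1,1)`-pairing over a domain

Blind re-derivation cell `pub-hodge-repro`, Tier 4 (README §9–§10), seat t4-plan-4 (gen 0).  Target tree path
`lean/Summits/Ventures/HodgeRepro/Tier4/Line4/Forms11.lean`.  Imports `Tier4/Line4/MixedTransfer.lean` (p661007: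
`Form11`, `wedgeCoeff11`, `mixedForm`, `u₁ … u₄`, `ξ₁₃`, `ξ₂₄`, `mixedPairing`, `pairing_eq_neg_mixedPairing`).

WHAT IS DEFINED (byte-identical to Skeleton.lean v0.3 f1e875e0… L170–L191 and L221–L225, so that the landing modules
of the provers of L4.2 `mixed_closed` and L4.2′ `mixed_smooth` state the registered signatures through the gate
without re-defining them): the Wirtinger derivatives `dz m f`, `dzbar n f` of a (not necessarily holomorphic)
function on `ℂ²` through the REAL Fréchet derivative; `IsClosed11 ξ` — `dξ = 0` for a `(1,1)`-form
`ξ = Σ ξ_{kl} dz_k ∧ dz̄_l` on the ball (`∂_m ξ_{kl}` symmetric in `(m, k)`, `∂̄_n ξ_{kl}` symmetric in `(n, l)`);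
`pair11 D ξ ξ′ = ∫_D ⟨ξ ∧ ξ′⟩` — the `(1,1)`-pairing over a domain (the intersection number `[ξ]·[ξ′]` when `D` is a
fundamental domain of `Γ′` and the forms are closed and `Γ′`-invariant); `Forms11`; `Smooth11 ξ` — real `C²` of the
coefficients on the ball.

WHAT IS PROVED.  `mixedPairing_eq_pair11`: the landed `mixedPairing d D h` is `pair11 D (ξ₁₃ d h) (ξ₂₄ d h)` (rfl);
`isLevel_Γ`: the datum's own level `Γ` is a level.  The pull-back, `Γ′`-invariance and L4.1 live in
`Tier4/Line4/MixedInvariant.lean` (t4-L4-p1, p661725); L4.2 / L4.2′ are the provers' modules.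

Nothing here says anything about the status of the Hodge conjecture for CM abelian varieties, which is NOT proved
(HC_CM is NOT proved by anyone in this repository).
-/

set_option autoImplicit false

noncomputable section

open Matrix MeasureTheory NumberField
open scoped ComplexConjugate ComplexOrder

namespace Summit.Ventures.HodgeRepro.Tier4.Line4

open Summit.Ventures.HodgeRepro.Tier4

variable {F E : Type} [Field F] [NumberField F] [IsGalois ℚ F] [IsCMField F]
  [Field E] [NumberField E] [IsGalois ℚ E] [IsCMField E] (d : TargetData F E)

/-! ## Wirtinger derivatives, closedness, the `(1,1)`-pairing -/

/-- The Wirtinger derivative `∂/∂z_m` of a (not necessarily holomorphic) function, via the REAL Fréchet derivative: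
`∂_m f = ½ (∂_{x_m} f − i ∂_{y_m} f)`. -/
def dz (m : Fin 2) (f : (Fin 2 → ℂ) → ℂ) (z : Fin 2 → ℂ) : ℂ :=
  (1 / 2 : ℂ) * (fderiv ℝ f z (Pi.single m 1) - Complex.I * fderiv ℝ f z (Pi.single m Complex.I))

/-- The Wirtinger derivative `∂/∂z̄_n`: `∂̄_n f = ½ (∂_{x_n} f + i ∂_{y_n} f)`. -/
def dzbar (n : Fin 2) (f : (Fin 2 → ℂ) → ℂ) (z : Fin 2 → ℂ) : ℂ :=
  (1 / 2 : ℂ) * (fderiv ℝ f z (Pi.single n 1) + Complex.I * fderiv ℝ f z (Pi.single n Complex.I))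

/-- Closedness `dξ = 0` of a `(1,1)`-form `ξ = Σ ξ_{kl} dz_k ∧ dz̄_l` on the ball: `∂_m ξ_{kl}` is symmetric in `(m, k)`
and `∂̄_n ξ_{kl}` is symmetric in `(n, l)`. -/
def IsClosed11 (ξ : (Fin 2 → ℂ) → Form11) : Prop :=
  ∀ z ∈ ball, (∀ k l m : Fin 2, dz m (fun w => ξ w k l) z = dz k (fun w => ξ w m l) z) ∧
    (∀ k l n : Fin 2, dzbar n (fun w => ξ w k l) z = dzbar l (fun w => ξ w k n) z)

/-- The `(1,1)`-pairing over `D`: `∫_D (coefficient of ξ ∧ ξ′)` — the intersection number `[ξ]·[ξ′]` when `D` is a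
fundamental domain of `Γ′` and `ξ, ξ′` are closed and `Γ′`-invariant. -/
def pair11 (D : Set (Fin 2 → ℂ)) (ξ ξ' : (Fin 2 → ℂ) → Form11) : ℂ :=
  ∫ z in D, wedgeCoeff11 (ξ z) (ξ' z)

/-- The landed `mixedPairing` is the `(1,1)`-pairing of the two mixed forms. -/
theorem mixedPairing_eq_pair11 (D : Set (Fin 2 → ℂ)) (h : Fin 4 → HeckeElement E) :
    mixedPairing d D h = pair11 D (ξ₁₃ d h) (ξ₂₄ d h) := rfl

/-- Every datum has a level: `Γ` itself. -/
theorem isLevel_Γ : d.IsLevel d.Γ := ⟨d.hΓ, subset_rfl⟩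

/-! ## Forms and smoothness -/

/-- `(1,1)`-forms on `ℂ²` as coefficient-matrix functions. -/
abbrev Forms11 := (Fin 2 → ℂ) → Form11

/-- `C²`-smoothness of a `(1,1)`-form on the ball (real sense). -/
def Smooth11 (ξ : Forms11) : Prop := ∀ k l : Fin 2, ContDiffOn ℝ 2 (fun z => ξ z k l) ball

end Summit.Ventures.HodgeRepro.Tier4.Line4

#print axioms Summit.Ventures.HodgeRepro.Tier4.Line4.mixedPairing_eq_pair11
#print axioms Summit.Ventures.HodgeRepro.Tier4.Line4.isLevel_Γ
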